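import Summits.Schanuel.Schanuel.Theorems.ApproximationProperty.Negative.ScaleExponentLiouville
import Literature.Barriers.Schanuel.EFunctionValuesAtAlgebraicPointsDetBounds

/-!
# `DiophantineDichotomy.ApproximationProperty` — negative lane: Liouville repulsion near a radical

Supporting NEGATIVE lemma for the crux `ApproximationProperty` (stmt-Schanuel-6117) of route
`DiophantineDichotomy` (cdisprove seat g2, 2026-08-16; work file
`Cruxes/ApproximationProperty/Disproof.lean` §5). Nothing here asserts a Theses statement.

* `radical_repulsion` — **Liouville repulsion near a radical point, norm form**: if `β ^ p = u`
  (`u ∈ ℕ`), `‖β‖ ≤ A`, `1 ≤ A`, and `γ ≠ β` is a root of a non-zero integer polynomial of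
  degree `≤ d` and height `≤ H` with `‖γ − β‖ ≤ 1`, then `1 ≤ d·((d+1)·4^d·H·A^d)^p·‖γ − β‖`.
  Taylor expansion at `β`: the trailing coefficient is a non-zero algebraic integer of `ℚ(β)`,
  of degree `≤ p`, with all conjugates `≤ B = (d+1)4^dHA^d` (the conjugates of `β` have modulus
  `u^{1/p}` too); its norm is a non-zero rational integer, so it is `≥ B^{-(p-1)}`
  (`Literature.Barriers.Schanuel.SiegelShidlovskii.one_le_norm_mul_pow_of_isIntegral`), while
  `P(γ) = 0` makes it `≤ d·B·‖γ − β‖` (`trailing_domination` of the sibling file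
  `ScaleExponentLiouville`, whose `repulsion` is the same statement at a RATIONAL centre).
  It is the tool of the forcing argument in `Negative/TrdegForcingStage.lean`,
  `Negative/TrdegForcing.lean` (the hypothesis `trdeg ℚ(θ) ≤ t` of the crux is load-bearing).
-/

set_option linter.dupNamespace false

noncomputable section

open Polynomial
open scoped IntermediateField
open Summit.Schanuel.Schanuel.Theorems.ApproximationPropertyScaleExponentLiouville
  (hasseDeriv_map abs_coeff_hasseDeriv_le trailing_domination)

namespace Summit.Schanuel.Schanuel.Theorems.ApproximationPropertyRadicalRepulsion

/-- Size of Hasse-derivative values: for `P` of degree `≤ d` and height `≤ H` and `‖z‖ ≤ A`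
(`1 ≤ A`), `‖(∂ⁿP/n!)(z)‖ ≤ (d+1)·4^d·H·A^d`. -/
theorem norm_aeval_hasseDeriv_le {P : ℤ[X]} {H : ℕ} (hco : ∀ k, |P.coeff k| ≤ (H : ℤ)) {d : ℕ}
    (hdeg : P.natDegree ≤ d) {z : ℂ} {A : ℝ} (hA1 : 1 ≤ A) (hz : ‖z‖ ≤ A) (n : ℕ) :
    ‖aeval z (hasseDeriv n P)‖ ≤ (d + 1) * 4 ^ d * H * A ^ d := by
  have hB0 : (0 : ℝ) ≤ (d + 1) * 4 ^ d * H * A ^ d := by positivity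
  rw [aeval_def, ← eval_map, algebraMap_int_eq]
  have hdegD : ((hasseDeriv n P).map (Int.castRingHom ℂ)).natDegree < d + 1 :=
    Nat.lt_succ_of_le ((natDegree_map_le).trans
      ((natDegree_hasseDeriv_le P n).trans ((Nat.sub_le _ _).trans hdeg)))
  rw [eval_eq_sum_range' hdegD]
  refine (norm_sum_le _ _).trans ?_
  have hterm : ∀ k ∈ Finset.range (d + 1),
      ‖((hasseDeriv n P).map (Int.castRingHom ℂ)).coeff k * z ^ k‖ ≤ 4 ^ d * H * A ^ d := by
    intro k hk
    have hkd : k ≤ d := Nat.lt_succ_iff.mp (Finset.mem_range.mp hk)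
    rw [norm_mul, norm_pow, coeff_map, Int.coe_castRingHom, Complex.norm_intCast]
    have h1 : |(((hasseDeriv n P).coeff k : ℤ) : ℝ)| ≤ 4 ^ d * H := by
      rcases le_or_gt n d with hnd | hnd
      · have := abs_coeff_hasseDeriv_le hco n k
        have h2 : (2 : ℝ) ^ (k + n) ≤ 4 ^ d := by
          calc (2 : ℝ) ^ (k + n) ≤ 2 ^ (d + d) := pow_le_pow_right₀ one_le_two (by omega)
            _ = 4 ^ d := by rw [← two_mul, pow_mul]; norm_num
        calc |(((hasseDeriv n P).coeff k : ℤ) : ℝ)| ≤ 2 ^ (k + n) * H := by exact_mod_cast this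
          _ ≤ 4 ^ d * H := by gcongr
      · -- for `n > d` the Hasse derivative of order `n` kills `P`
        have hz : (hasseDeriv n P).coeff k = 0 := by
          rw [hasseDeriv_coeff]
          have : P.coeff (k + n) = 0 := coeff_eq_zero_of_natDegree_lt (by omega)
          rw [this, mul_zero]
        rw [hz, Int.cast_zero, abs_zero]
        positivity
    have h3 : ‖z‖ ^ k ≤ A ^ d :=
      (pow_le_pow_left₀ (norm_nonneg _) hz k).trans (pow_le_pow_right₀ hA1 hkd)
    exact mul_le_mul h1 h3 (by positivity) (by positivity)
  refine (Finset.sum_le_sum hterm).trans ?_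
  rw [Finset.sum_const, Finset.card_range, nsmul_eq_mul]
  push_cast
  ring_nf
  exact le_rfl

/-- **Liouville repulsion near a radical point (norm form).** Let `β ∈ ℂ` with `β ^ p = u`,
`u` a natural number, `p ≥ 1`, `‖β‖ ≤ A`, `1 ≤ A`. If `γ ≠ β` is a root of a non-zero integer
polynomial of degree `≤ d` and height `≤ H` with `‖γ − β‖ ≤ 1`, then
`1 ≤ d · ((d+1)·4^d·H·A^d)^p · ‖γ − β‖`.
Proof: Taylor-expand `P` at `β`; the trailing Taylor coefficient `T_k = (∂ᵏP/k!)(β)` is a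
non-zero algebraic INTEGER of `ℚ(β)` (degree `≤ p`) all of whose conjugates are bounded by
`B = (d+1)4^dHA^d` (the conjugates of `β` have the same modulus `u^{1/p}`), so
`‖T_k‖ ≥ B^{-(p-1)}` (the norm is a non-zero rational integer:
`Literature.Barriers.Schanuel.SiegelShidlovskii.one_le_norm_mul_pow_of_isIntegral`), while
`P(γ) = 0` makes `T_k` dominated by `d·B·‖γ − β‖` (`trailing_domination`). This is
`ApproximationPropertyScaleExponentLiouville.repulsion` with `a/b` replaced by `u^{1/p}` and the
denominator bound `b^{-d}` replaced by the norm. -/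
theorem radical_repulsion {P : ℤ[X]} {d H : ℕ} (hP0 : P ≠ 0) (hdeg : P.natDegree ≤ d)
    (hco : ∀ k, |P.coeff k| ≤ (H : ℤ)) {γ β : ℂ} (hγ : aeval γ P = 0) {p u : ℕ} (hp : 0 < p)
    (hβ : β ^ p = u) {A : ℝ} (hA1 : 1 ≤ A) (hA : ‖β‖ ≤ A) (hne : γ ≠ β)
    (hclose : ‖γ - β‖ ≤ 1) :
    1 ≤ (d * ((d + 1) * 4 ^ d * H * A ^ d) ^ p) * ‖γ - β‖ := by
  classical
  set B : ℝ := (d + 1) * 4 ^ d * H * A ^ d with hB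
  -- the field `K = ℚ(β)` and its generator
  set K : IntermediateField ℚ ℂ := IntermediateField.adjoin ℚ {β} with hK
  have hβK : β ∈ K := IntermediateField.mem_adjoin_simple_self ℚ β
  set β' : K := ⟨β, hβK⟩ with hβ'
  have hβ'pow : β' ^ p = (u : K) := by
    apply Subtype.val_injective
    simp [hβ', hβ]
  have hβ'int : IsIntegral ℤ β' := by
    refine ⟨X ^ p - C (u : ℤ), monic_X_pow_sub_C _ hp.ne', ?_⟩
    simp [hβ'pow]
  have hβint : IsIntegral ℚ β := by
    have h1 : IsIntegral ℚ β' := hβ'int.tower_top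
    have h2 := h1.map (IntermediateField.val K)
    simpa [hβ'] using h2
  haveI : FiniteDimensional ℚ K := IntermediateField.adjoin.finiteDimensional hβint
  -- `[K : ℚ] ≤ p`
  have hfin : Module.finrank ℚ K ≤ p := by
    rw [hK, IntermediateField.adjoin.finrank hβint]
    have hq0 : (X ^ p - C (u : ℚ) : ℚ[X]) ≠ 0 := X_pow_sub_C_ne_zero hp _
    have hroot : aeval β (X ^ p - C (u : ℚ) : ℚ[X]) = 0 := by simp [hβ]
    have := minpoly.degree_le_of_ne_zero ℚ β hq0 hroot
    calc (minpoly ℚ β).natDegree ≤ (X ^ p - C (u : ℚ) : ℚ[X]).natDegree :=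
          natDegree_le_natDegree this
      _ = p := natDegree_X_pow_sub_C
  -- Taylor expansion at `β`
  set T : ℂ[X] := taylor β (P.map (Int.castRingHom ℂ)) with hT
  have hmap0 : P.map (Int.castRingHom ℂ) ≠ 0 :=
    (Polynomial.map_ne_zero_iff Int.cast_injective).mpr hP0
  have hT0 : T ≠ 0 := fun h => hmap0 (taylor_injective β (by rw [← hT, h, map_zero]))
  have hTeval : T.eval (γ - β) = 0 := by
    rw [hT, taylor_eval, sub_add_cancel, eval_map, ← algebraMap_int_eq, ← aeval_def, hγ]
  have hTdeg : T.natDegree ≤ d := by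
    rw [hT, natDegree_taylor]
    exact natDegree_map_le.trans hdeg
  have hTcoeff : ∀ k, T.coeff k = aeval β (hasseDeriv k P) := fun k => by
    rw [hT, taylor_coeff, hasseDeriv_map, eval_map, ← algebraMap_int_eq, ← aeval_def]
  -- upper bound for all Taylor coefficients
  have hup : ∀ k, ‖T.coeff k‖ ≤ B := fun k => by
    rw [hTcoeff]; exact norm_aeval_hasseDeriv_le hco hdeg hA1 hA k
  have hB1 : 1 ≤ B := by
    have h1 : (1 : ℝ) ≤ (d + 1) := by
      have : (0 : ℝ) ≤ d := Nat.cast_nonneg d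
      linarith
    have h2 : (1 : ℝ) ≤ 4 ^ d := one_le_pow₀ (by norm_num)
    have h4 : (1 : ℝ) ≤ A ^ d := one_le_pow₀ hA1
    -- `H ≥ 1` because `P ≠ 0` has a coefficient of absolute value `≥ 1`
    have h3 : (1 : ℝ) ≤ H := by
      have hlc : P.leadingCoeff ≠ 0 := leadingCoeff_ne_zero.mpr hP0
      have := hco P.natDegree
      have h1' : (1 : ℤ) ≤ H := (Int.one_le_abs hlc).trans this
      exact_mod_cast h1'
    rw [hB]
    calc (1 : ℝ) = 1 * 1 * 1 * 1 := by ring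
      _ ≤ (d + 1) * 4 ^ d * H * A ^ d := by gcongr
  -- lower bound for the NON-ZERO Taylor coefficients, by the norm
  have hlow : ∀ k, T.coeff k ≠ 0 → 1 / B ^ (p - 1) ≤ ‖T.coeff k‖ := by
    intro k hk
    -- the coefficient as an element of `K`
    set x : K := aeval β' (hasseDeriv k P) with hx
    have hxC : (x : ℂ) = T.coeff k := by
      rw [hTcoeff, hx, hβ']
      exact (aeval_algebraMap_apply ℂ (⟨β, hβK⟩ : K) (hasseDeriv k P)).symm
    have hx0 : x ≠ 0 := fun h => hk (by rw [← hxC, h]; rfl)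
    have hxint : IsIntegral ℤ x :=
      (mem_integralClosure_iff ℤ K).mp
        (adjoin_le_integralClosure hβ'int (aeval_mem_adjoin_singleton ℤ β'))
    -- conjugate bound
    have hσ : ∀ σ : K →ₐ[ℚ] ℂ, ‖σ x‖ ≤ B := by
      intro σ
      have hσx : σ x = aeval (σ β') (hasseDeriv k P) := by
        rw [hx, ← aeval_map_algebraMap ℚ β' (hasseDeriv k P), ← aeval_algHom_apply,
          aeval_map_algebraMap]
      have hσβ : ‖σ β'‖ ≤ A := by
        have h1 : (σ β') ^ p = u := by
          rw [← map_pow, hβ'pow]; simp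
        have h2 : ‖σ β'‖ ^ p = ‖β‖ ^ p := by
          rw [← norm_pow, ← norm_pow, h1, hβ]
        have h3 : ‖σ β'‖ = ‖β‖ := (pow_left_inj₀ (norm_nonneg _) (norm_nonneg _) hp.ne').mp h2
        rw [h3]; exact hA
      rw [hσx]
      exact norm_aeval_hasseDeriv_le hco hdeg hA1 hσβ k
    have key := Literature.Barriers.Schanuel.SiegelShidlovskii.one_le_norm_mul_pow_of_isIntegral
      K hx0 hxint hσ
    rw [hxC] at key
    -- `B^(finrank - 1) ≤ B^(p-1)`
    have hmono : B ^ (Module.finrank ℚ K - 1) ≤ B ^ (p - 1) :=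
      pow_le_pow_right₀ hB1 (Nat.sub_le_sub_right hfin 1)
    have key' : 1 ≤ ‖T.coeff k‖ * B ^ (p - 1) :=
      key.trans (mul_le_mul_of_nonneg_left hmono (norm_nonneg _))
    rw [div_le_iff₀ (pow_pos (lt_of_lt_of_le one_pos hB1) _)]
    exact key'
  -- trailing domination
  have dom := trailing_domination hT0 hTeval (sub_ne_zero.mpr hne) hclose hTdeg hup hlow
  -- `1/B^(p-1) ≤ d * B * ‖γ - β‖` ⇒ `1 ≤ d * B^p * ‖γ - β‖`
  have hBp : (0 : ℝ) < B ^ (p - 1) := pow_pos (lt_of_lt_of_le one_pos hB1) _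
  rw [div_le_iff₀ hBp] at dom
  have hpow : B * B ^ (p - 1) = B ^ p := by
    rw [← pow_succ']; congr 1; omega
  calc (1 : ℝ) ≤ d * B * ‖γ - β‖ * B ^ (p - 1) := dom
    _ = d * (B * B ^ (p - 1)) * ‖γ - β‖ := by ring
    _ = d * B ^ p * ‖γ - β‖ := by rw [hpow]



end Summit.Schanuel.Schanuel.Theorems.ApproximationPropertyRadicalRepulsion

end
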